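import Summits.QuantumFields.YangMills.Theorems.AtomicCalibrationRFlatLeibniz

/-!
# AtomicCalibrationR (stmt-QuantumFields-28169), E2 `stub_offDiagonalWhitney` — Leibniz bounds with factorial (Gevrey) rates
# (roadmap v3 item G.3, third instance; prover w4 g22, free hands)

Factorial-weighted versions of `TelescopingAssembly.norm_iteratedFDeriv_mul_le_add_pow` / `norm_iteratedFDeriv_sub_le_pow` and of
`FlatLeibniz.norm_iteratedFDeriv_mul_le_of_flat(')`: rates `(j!)^s M^j` in place of `M^j`.  The binomial step uses
`i! (m−i)! ≤ m!`.

* `factorial_mul_factorial_le` — `(i!)^s ((m−i)!)^s ≤ (m!)^s` for `i ≤ m`;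
* `norm_iteratedFDeriv_mul_le_add_pow_factorial` — `‖D^m (fg)‖ ≤ (m!)^s (M₁+M₂)^m`;
* `norm_iteratedFDeriv_sub_le_pow_factorial` — difference of two `‖·‖ ≤ 1` functions with rates `(j!)^s M^j` (`j ≥ 1`, `M ≥ 1`):
  rates `(j!)^s (2M)^j`;
* `norm_iteratedFDeriv_mul_le_of_flat_factorial(')` — flat `F` (`‖D^jF‖ ≤ P r^{K−j}`) times a Gevrey bump
  (`‖D^iΦ‖ ≤ Q (i!)^s s^{−i}`): `‖D^m(FΦ)‖ ≤ (m!)^s P Q (1+r/s)^m r^{K−m}` and the Whitney form `/ s^m`.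

Mathlib (+ `FlatLeibniz.sum_choose_flat_eq`) only; no stub/crux/rung/summit is closed; nothing here touches Yang–Mills; the YM mass gap
is NOT proved. [folklore]
-/

set_option autoImplicit false

noncomputable section

open scoped BigOperators ContDiff
open Summit.QuantumFields.YangMills.Cruxes.AtomicCalibrationR.FlatLeibniz (sum_choose_flat_eq)

namespace Summit.QuantumFields.YangMills.Cruxes.AtomicCalibrationR.GevreyLeibniz

variable {E : Type*} [NormedAddCommGroup E] [NormedSpace ℝ E] {A : Type*} [NormedRing A] [NormedAlgebra ℝ A]

/-- `(i!)^s ((m-i)!)^s ≤ (m!)^s` for `i ≤ m`. -/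
theorem factorial_mul_factorial_le {i m : ℕ} (hi : i ≤ m) (s : ℕ) :
    ((Nat.factorial i : ℕ) : ℝ) ^ s * ((Nat.factorial (m - i) : ℕ) : ℝ) ^ s ≤ ((Nat.factorial m : ℕ) : ℝ) ^ s := by
  rw [← mul_pow]
  refine pow_le_pow_left₀ (by positivity) ?_ s
  have h := Nat.le_of_dvd (Nat.factorial_pos m) (Nat.factorial_mul_factorial_dvd_factorial hi)
  exact_mod_cast h

/-- **Two-factor bound, factorial rates**: `‖D^j f‖ ≤ (j!)^s M₁^j`, `‖D^j g‖ ≤ (j!)^s M₂^j` (`j ≤ m`) ⇒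
`‖D^m (fg)‖ ≤ (m!)^s (M₁+M₂)^m`. [folklore] -/
theorem norm_iteratedFDeriv_mul_le_add_pow_factorial {f g : E → A} (hf : ContDiff ℝ ∞ f) (hg : ContDiff ℝ ∞ g)
    {M₁ M₂ : ℝ} (hM₁ : 0 ≤ M₁) (hM₂ : 0 ≤ M₂) (s m : ℕ) (z : E)
    (hfb : ∀ j : ℕ, j ≤ m → ‖iteratedFDeriv ℝ j f z‖ ≤ ((Nat.factorial j : ℕ) : ℝ) ^ s * M₁ ^ j)
    (hgb : ∀ j : ℕ, j ≤ m → ‖iteratedFDeriv ℝ j g z‖ ≤ ((Nat.factorial j : ℕ) : ℝ) ^ s * M₂ ^ j) :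
    ‖iteratedFDeriv ℝ m (fun x => f x * g x) z‖ ≤ ((Nat.factorial m : ℕ) : ℝ) ^ s * (M₁ + M₂) ^ m := by
  have h1 := norm_iteratedFDeriv_mul_le (𝕜 := ℝ) (N := (⊤ : ℕ∞)) hf hg z (n := m) (by exact_mod_cast le_top)
  refine h1.trans ?_
  rw [add_pow, Finset.mul_sum]
  refine Finset.sum_le_sum fun i hi => ?_
  have him : i ≤ m := Nat.lt_succ_iff.1 (Finset.mem_range.1 hi)
  have hfac := factorial_mul_factorial_le him s
  calc (m.choose i : ℝ) * ‖iteratedFDeriv ℝ i f z‖ * ‖iteratedFDeriv ℝ (m - i) g z‖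
      ≤ (m.choose i : ℝ) * (((Nat.factorial i : ℕ) : ℝ) ^ s * M₁ ^ i) *
          (((Nat.factorial (m - i) : ℕ) : ℝ) ^ s * M₂ ^ (m - i)) := by
        refine mul_le_mul (mul_le_mul_of_nonneg_left (hfb i him) (Nat.cast_nonneg _)) (hgb (m - i) (Nat.sub_le m i))
          (norm_nonneg _) (mul_nonneg (Nat.cast_nonneg _) (by positivity))
    _ = (((Nat.factorial i : ℕ) : ℝ) ^ s * ((Nat.factorial (m - i) : ℕ) : ℝ) ^ s) *
          (M₁ ^ i * M₂ ^ (m - i) * (m.choose i : ℝ)) := by ring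
    _ ≤ ((Nat.factorial m : ℕ) : ℝ) ^ s * (M₁ ^ i * M₂ ^ (m - i) * (m.choose i : ℝ)) :=
        mul_le_mul_of_nonneg_right hfac (by positivity)

/-- **Difference bound, factorial rates**: `‖f z − g z‖ ≤ 1` and rates `(j!)^s M^j` (`j ≥ 1`, `M ≥ 1`) for `f, g` ⇒ the
difference has rates `(j!)^s (2M)^j` for all `j ≤ m`. -/
theorem norm_iteratedFDeriv_sub_le_pow_factorial {f g : E → A} (hf : ContDiff ℝ ∞ f) (hg : ContDiff ℝ ∞ g) {M : ℝ}
    (hM : 1 ≤ M) (s m : ℕ) (z : E) (hf0 : ‖f z - g z‖ ≤ 1)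
    (hfb : ∀ j : ℕ, 1 ≤ j → j ≤ m → ‖iteratedFDeriv ℝ j f z‖ ≤ ((Nat.factorial j : ℕ) : ℝ) ^ s * M ^ j)
    (hgb : ∀ j : ℕ, 1 ≤ j → j ≤ m → ‖iteratedFDeriv ℝ j g z‖ ≤ ((Nat.factorial j : ℕ) : ℝ) ^ s * M ^ j) :
    ∀ j : ℕ, j ≤ m → ‖iteratedFDeriv ℝ j (fun x => f x - g x) z‖ ≤ ((Nat.factorial j : ℕ) : ℝ) ^ s * (2 * M) ^ j := by
  intro j hj
  rcases Nat.eq_zero_or_pos j with rfl | hjpos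
  · rw [pow_zero, norm_iteratedFDeriv_zero, Nat.factorial_zero, Nat.cast_one, one_pow, one_mul]; exact hf0
  · have hsub : iteratedFDeriv ℝ j (fun x => f x - g x) z = iteratedFDeriv ℝ j f z - iteratedFDeriv ℝ j g z :=
      iteratedFDeriv_sub_apply (𝕜 := ℝ) (f := f) (g := g) (i := j) (x := z)
        (hf.contDiffAt.of_le (by exact_mod_cast le_top)) (hg.contDiffAt.of_le (by exact_mod_cast le_top))
    rw [hsub]
    have hfac1 : (1 : ℝ) ≤ ((Nat.factorial j : ℕ) : ℝ) ^ s :=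
      one_le_pow₀ (by exact_mod_cast Nat.one_le_iff_ne_zero.2 (Nat.factorial_ne_zero j))
    calc ‖iteratedFDeriv ℝ j f z - iteratedFDeriv ℝ j g z‖
        ≤ ((Nat.factorial j : ℕ) : ℝ) ^ s * M ^ j + ((Nat.factorial j : ℕ) : ℝ) ^ s * M ^ j :=
          (norm_sub_le _ _).trans (add_le_add (hfb j hjpos hj) (hgb j hjpos hj))
      _ = ((Nat.factorial j : ℕ) : ℝ) ^ s * (2 * M ^ j) := by ring
      _ ≤ ((Nat.factorial j : ℕ) : ℝ) ^ s * (2 * M) ^ j := by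
          refine mul_le_mul_of_nonneg_left ?_ (by positivity)
          rw [mul_pow]
          exact mul_le_mul_of_nonneg_right (le_self_pow₀ (by norm_num) (by omega)) (pow_nonneg (by linarith) _)

/-- **Flat × Gevrey bump**: `‖D^j F(z)‖ ≤ P r^{K−j}`, `‖D^i Φ(z)‖ ≤ Q (i!)^s s^{−i}` (orders `≤ m`, `m ≤ K`, `r ≥ 0`) ⇒
`‖D^m (FΦ)(z)‖ ≤ (m!)^s P Q (1 + r/s)^m r^{K−m}`. [folklore] -/
theorem norm_iteratedFDeriv_mul_le_of_flat_factorial {F Φ : E → A} (hF : ContDiff ℝ ∞ F) (hΦ : ContDiff ℝ ∞ Φ) {m K : ℕ}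
    (hmK : m ≤ K) {P Q r s : ℝ} (hP : 0 ≤ P) (hQ : 0 ≤ Q) (hr : 0 ≤ r) (hs : 0 < s) (sx : ℕ) (z : E)
    (hFb : ∀ j : ℕ, j ≤ m → ‖iteratedFDeriv ℝ j F z‖ ≤ P * r ^ (K - j))
    (hΦb : ∀ i : ℕ, i ≤ m → ‖iteratedFDeriv ℝ i Φ z‖ ≤ Q * ((Nat.factorial i : ℕ) : ℝ) ^ sx * s⁻¹ ^ i) :
    ‖iteratedFDeriv ℝ m (fun x => F x * Φ x) z‖ ≤ ((Nat.factorial m : ℕ) : ℝ) ^ sx * (P * Q * (1 + r / s) ^ m * r ^ (K - m)) := by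
  have h1 := norm_iteratedFDeriv_mul_le (𝕜 := ℝ) (N := (⊤ : ℕ∞)) hF hΦ z (n := m) (by exact_mod_cast le_top)
  refine h1.trans ?_
  rw [← sum_choose_flat_eq hmK P Q r s, Finset.mul_sum]
  refine Finset.sum_le_sum fun i hi => ?_
  have him : i ≤ m := Nat.lt_succ_iff.1 (Finset.mem_range.1 hi)
  have hFi := hFb i him
  have hΦi := hΦb (m - i) (Nat.sub_le m i)
  have h0 : 0 ≤ P * r ^ (K - i) := mul_nonneg hP (pow_nonneg hr _)
  have hfac : ((Nat.factorial (m - i) : ℕ) : ℝ) ^ sx ≤ ((Nat.factorial m : ℕ) : ℝ) ^ sx :=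
    pow_le_pow_left₀ (by positivity) (by exact_mod_cast Nat.factorial_le (Nat.sub_le m i)) sx
  calc (m.choose i : ℝ) * ‖iteratedFDeriv ℝ i F z‖ * ‖iteratedFDeriv ℝ (m - i) Φ z‖
      ≤ (m.choose i : ℝ) * (P * r ^ (K - i)) * (Q * ((Nat.factorial (m - i) : ℕ) : ℝ) ^ sx * s⁻¹ ^ (m - i)) := by
        refine mul_le_mul (mul_le_mul_of_nonneg_left hFi (Nat.cast_nonneg _)) hΦi (norm_nonneg _) ?_
        exact mul_nonneg (Nat.cast_nonneg _) h0
    _ = ((Nat.factorial (m - i) : ℕ) : ℝ) ^ sx * ((m.choose i : ℝ) * (P * r ^ (K - i)) * (Q * s⁻¹ ^ (m - i))) := by ring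
    _ ≤ ((Nat.factorial m : ℕ) : ℝ) ^ sx * ((m.choose i : ℝ) * (P * r ^ (K - i)) * (Q * s⁻¹ ^ (m - i))) :=
        mul_le_mul_of_nonneg_right hfac (by positivity)

/-- **Whitney form** of the previous bound (`0 < s ≤ r`): `≤ (m!)^s · (P Q (1+r/s)^m r^K) / s^m`. -/
theorem norm_iteratedFDeriv_mul_le_of_flat_factorial' {F Φ : E → A} (hF : ContDiff ℝ ∞ F) (hΦ : ContDiff ℝ ∞ Φ) {m K : ℕ}
    (hmK : m ≤ K) {P Q r s : ℝ} (hP : 0 ≤ P) (hQ : 0 ≤ Q) (hs : 0 < s) (hsr : s ≤ r) (sx : ℕ) (z : E)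
    (hFb : ∀ j : ℕ, j ≤ m → ‖iteratedFDeriv ℝ j F z‖ ≤ P * r ^ (K - j))
    (hΦb : ∀ i : ℕ, i ≤ m → ‖iteratedFDeriv ℝ i Φ z‖ ≤ Q * ((Nat.factorial i : ℕ) : ℝ) ^ sx * s⁻¹ ^ i) :
    ‖iteratedFDeriv ℝ m (fun x => F x * Φ x) z‖ ≤
      ((Nat.factorial m : ℕ) : ℝ) ^ sx * (P * Q * (1 + r / s) ^ m * r ^ K / s ^ m) := by
  have hr : 0 ≤ r := hs.le.trans hsr
  refine (norm_iteratedFDeriv_mul_le_of_flat_factorial hF hΦ hmK hP hQ hr hs sx z hFb hΦb).trans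
    (mul_le_mul_of_nonneg_left ?_ (by positivity))
  rw [le_div_iff₀ (pow_pos hs m)]
  have hK : r ^ K = r ^ (K - m) * r ^ m := by rw [← pow_add, Nat.sub_add_cancel hmK]
  rw [hK]
  have hC : 0 ≤ P * Q * (1 + r / s) ^ m := mul_nonneg (mul_nonneg hP hQ) (pow_nonneg (by positivity) _)
  have hsm : s ^ m ≤ r ^ m := pow_le_pow_left₀ hs.le hsr m
  calc P * Q * (1 + r / s) ^ m * r ^ (K - m) * s ^ m
      ≤ P * Q * (1 + r / s) ^ m * r ^ (K - m) * r ^ m :=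
        mul_le_mul_of_nonneg_left hsm (mul_nonneg hC (pow_nonneg hr _))
    _ = P * Q * (1 + r / s) ^ m * (r ^ (K - m) * r ^ m) := by ring

end Summit.QuantumFields.YangMills.Cruxes.AtomicCalibrationR.GevreyLeibniz

end
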